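import Summits.BirchSwinnertonDyer.BirchSwinnertonDyer.Theorems.ThetaPartnerAtTwoMazurTateCongruenceAtTwoROfPlusLine
import Summits.BirchSwinnertonDyer.BirchSwinnertonDyer.Theorems.ThetaPartnerAtTwoMazurTateCongruenceAtTwoROfSymbolParity
import Summits.BirchSwinnertonDyer.BirchSwinnertonDyer.Theorems.ResidualThetaTransportAtTwoThetaLayerLambdaCongruenceAtTwoDepletionExact
import HarnessLib

/-!
# Crux `MazurTateCongruenceAtTwoTop` (stmt-BirchSwinnertonDyer-25797 = 21416), line `symbol`: the plus-line parity law READ IN THE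
# CURRENCY OF THE REGISTERED STUB — at the `2`-power cusps the Greenberg–Vatsal expanded depleted table equals the Literature
# list-iterated table `eulerDepleteTableList`, so (PAR2) of `…ROfSymbolParity` holds for every rank-`0` partner with `Δ_W < 0`
# granted the six named facts, the trace congruence and the two `μ`-hypotheses (lead prover bsd-wall-tp2-p1 g10; `--supports 25797`)

HONEST FRAMING. THEOREMS ONLY; the six facts, the trace congruence and the two `μ`-hypotheses are explicit hypotheses; BSD is not
proved by any of this.

WHAT. (§1) The expanded depleted table `Ψ^{S₀}(r) = Σ_{k : S₀ → {0,1,2}} (∏_v c_{v,k_v} ℓ_v^{−k_v})·[r∏ℓ_v^{k_v}]⁺` (currency of route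
ResidualThetaTransportAtTwo) is a rational number whose images in `ℚ₂` / `ℚ̄₂` are the tree's `K`-valued expanded tables; (§2) at
the layer cusps `5^s/2^{n+2}` it EQUALS `eulerDepleteTableList W S₀.toList [·]⁺ (5^s/2^{n+2})` (both layer sums are
`≡ ϑ_n([·]⁺)·∏P_v∘(ℓ⁻¹(1+X)^{e_v}) (mod ω_n)` — `layerSum_mul_prod_eulerFactor_congr` (RTT) and
`layerSum_mul_prod_dvd_sub_layerSum_eulerDepleteTableList` (this line) — and have degree `< 2ⁿ`); (§3) hence the bridge
`depletedParity_of_congruent_of_facts` (`…ROfPlusLine`) yields (PAR2) at every odd-numerator `2`-power cusp: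
`‖2ϖΦ^l_W(a/2^{n+2}) − 2ϖ_AΦ^l_A(a/2^{n+2})‖₂ ≤ ‖2‖₂`, `l = S₀.toList` (`parity_cusps_of_congruent_of_facts`).

References: [GreenbergVatsal2000] §1 (8), Thm. (1.4), §3 (13); [Vatsal1999] Thm. (1.13); [Buzzard2000LevelLoweringModTwo] Prop. 2.4.
-/

set_option linter.dupNamespace false
set_option autoImplicit false

noncomputable section

open scoped Classical MatrixGroups Polynomial

open CongruenceSubgroup Polynomial Literature.NumberTheory.EllipticCurves Literature.NumberTheory.EllipticCurves.ModularForms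
  Literature.NumberTheory.EllipticCurves.GreenbergVatsal2000
  Summit.BirchSwinnertonDyer.BirchSwinnertonDyer.Theorems.ThetaLayerLambdaCongruenceAtTwo

namespace Summit.BirchSwinnertonDyer.BirchSwinnertonDyer.Theorems.MazurTateCongruenceAtTwoR

/-! ## §1. The rational expanded table and its images in `ℚ₂`, `ℚ̄₂` -/

section Cast

variable (W : WeierstrassCurve ℚ) {N : ℕ} (f : CuspForm (Gamma0 N) 2)
  (S₀ : Finset (IsDedekindDomain.HeightOneSpectrum (NumberField.RingOfIntegers ℚ)))

/-- The `K`-valued expanded depleted table is the image of the rational one (`K` a field of characteristic `0`).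
[cite: GreenbergVatsal2000, §1 p. 9 (display (8))] -/
theorem expandedTable_eq_algebraMap (K : Type*) [Field K] [CharZero K] (r : ℚ) :
    (∑ k ∈ Fintype.piFinset (fun _ : S₀ ↦ Finset.range 3), (∏ v : S₀, ((W.localPolynomialAt (v : IsDedekindDomain.HeightOneSpectrum (NumberField.RingOfIntegers ℚ))).map (Int.castRingHom (K))).coeff (k v) * ((Rat.HeightOneSpectrum.natGenerator (v : IsDedekindDomain.HeightOneSpectrum (NumberField.RingOfIntegers ℚ)) : K)⁻¹) ^ (k v)) * algebraMap ℚ (K) (ratPlusSymbol f (r * ((∏ v : S₀, Rat.HeightOneSpectrum.natGenerator (v : IsDedekindDomain.HeightOneSpectrum (NumberField.RingOfIntegers ℚ)) ^ (k v) : ℕ) : ℚ)))) = algebraMap ℚ K (∑ k ∈ Fintype.piFinset (fun _ : S₀ ↦ Finset.range 3), (∏ v : S₀, (((W.localPolynomialAt (v : IsDedekindDomain.HeightOneSpectrum (NumberField.RingOfIntegers ℚ))).coeff (k v) : ℤ) : ℚ) * ((Rat.HeightOneSpectrum.natGenerator (v : IsDedekindDomain.HeightOneSpectrum (NumberField.RingOfIntegers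 ℚ)) : ℚ)⁻¹) ^ (k v)) * ratPlusSymbol f (r * ((∏ v : S₀, Rat.HeightOneSpectrum.natGenerator (v : IsDedekindDomain.HeightOneSpectrum (NumberField.RingOfIntegers ℚ)) ^ (k v) : ℕ) : ℚ))) := by
  simp only [map_mul, map_sum, map_prod, map_pow, map_inv₀, map_natCast, map_intCast, Polynomial.coeff_map, eq_intCast]

end Cast

/-! ## §2. At the layer cusps the expanded table equals the list-iterated table -/

section Link

variable (W : WeierstrassCurve ℚ) {N : ℕ} [NeZero N] (f : CuspForm (Gamma0 N) 2)
  (S₀ : Finset (IsDedekindDomain.HeightOneSpectrum (NumberField.RingOfIntegers ℚ)))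

/-- Reading coefficients of a layer sum: `Σ_s c_s (X+1)^s = Σ_s c'_s (X+1)^s ⟹ c_s = c'_s` (substitute `X ↦ X − 1`). [folklore] -/
theorem layerSum_coeff_injective {K : Type*} [Field K] {n : ℕ} (c c' : ZMod (2 ^ n) → K)
    (h : (∑ s : ZMod (2 ^ n), C (c s) * (X + 1 : K[X]) ^ s.val) = ∑ s : ZMod (2 ^ n), C (c' s) * (X + 1 : K[X]) ^ s.val)
    (s : ZMod (2 ^ n)) : c s = c' s := by
  have key : ∀ (d : ZMod (2 ^ n) → K),
      ((∑ t : ZMod (2 ^ n), C (d t) * (X + 1 : K[X]) ^ t.val).comp (X - 1)).coeff s.val = d s := by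
    intro d
    rw [← Polynomial.coe_compRingHom_apply, map_sum, Polynomial.finsetSum_coeff]
    have e : ∀ t : ZMod (2 ^ n), (Polynomial.compRingHom (X - 1 : K[X]) (C (d t) * (X + 1 : K[X]) ^ t.val)).coeff s.val =
        if s.val = t.val then d t else 0 := by
      intro t
      rw [Polynomial.coe_compRingHom_apply, Polynomial.mul_comp, Polynomial.C_comp, Polynomial.pow_comp,
        Polynomial.add_comp, Polynomial.X_comp, Polynomial.one_comp, sub_add_cancel, Polynomial.coeff_C_mul_X_pow]
    simp only [e]
    rw [Finset.sum_eq_single s (fun t _ hts ↦ if_neg fun hv ↦ hts (ZMod.val_injective _ hv.symm)) (by simp),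
      if_pos rfl]
  have h1 := key c
  have h2 := key c'
  rw [h] at h1
  rw [← h1, h2]

/-- **At the layer cusps the expanded depleted table is the list-iterated one**: for a finite set `S₀` of odd places,
`Ψ^{S₀}(5^s/2^{n+2}) = eulerDepleteTableList W S₀.toList [·]⁺_f (5^s/2^{n+2})`. Both layer sums are congruent to
`ϑ_n([·]⁺)·∏_v P_v∘(ℓ_v⁻¹(1+X)^{e_v})` modulo the monic `(X+1)^{2ⁿ} − 1` and have degree `< 2ⁿ`.
[cite: GreenbergVatsal2000, §1 p. 9 (display (8))] -/
theorem expandedTable_cusp_eq_eulerDepleteTableList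
    (hS2 : ∀ v ∈ S₀, ((2 : ℕ) : NumberField.RingOfIntegers ℚ) ∉ v.asIdeal) (n : ℕ) (s : ZMod (2 ^ n)) :
    (∑ k ∈ Fintype.piFinset (fun _ : S₀ ↦ Finset.range 3), (∏ v : S₀, (((W.localPolynomialAt (v : IsDedekindDomain.HeightOneSpectrum (NumberField.RingOfIntegers ℚ))).coeff (k v) : ℤ) : ℚ) * ((Rat.HeightOneSpectrum.natGenerator (v : IsDedekindDomain.HeightOneSpectrum (NumberField.RingOfIntegers ℚ)) : ℚ)⁻¹) ^ (k v)) * ratPlusSymbol f (((((cyclotomicGenerator 2 : ZMod (2 ^ (n + 2))) ^ s.val).val : ℚ) / (2 : ℚ) ^ (n + 2)) * ((∏ v : S₀, Rat.HeightOneSpectrum.natGenerator (v : IsDedekindDomain.HeightOneSpectrum (NumberField.RingOfIntegers ℚ)) ^ (k v) : ℕ) : ℚ))) = eulerDepleteTableList W S₀.toList (ratPlusSymbol f) ((((cyclotomicGenerator 2 : ZMod (2 ^ (n + 2))) ^ s.val).val : ℚ) / (2 : ℚ) ^ (n + 2)) := by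
  have hodd : ∀ v ∈ S₀, ¬ 2 ∣ Rat.HeightOneSpectrum.natGenerator v := fun v hv ↦ not_two_dvd_natGenerator (hS2 v hv)
  have hoddl : ∀ v ∈ S₀.toList, ¬ 2 ∣ Rat.HeightOneSpectrum.natGenerator v :=
    fun v hv ↦ hodd v (Finset.mem_toList.mp hv)
  have hneg : ∀ x, (fun x ↦ ((ratPlusSymbol f x : ℚ) : ℚ_[2])) (-x) = (fun x ↦ ((ratPlusSymbol f x : ℚ) : ℚ_[2])) x :=
    fun x ↦ by show ((ratPlusSymbol f (-x) : ℚ) : ℚ_[2]) = _; rw [ratPlusSymbol_neg]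
  have hper : ∀ (x : ℚ) (k : ℤ), (fun x ↦ ((ratPlusSymbol f x : ℚ) : ℚ_[2])) (x + k) =
      (fun x ↦ ((ratPlusSymbol f x : ℚ) : ℚ_[2])) x :=
    fun x k ↦ by show ((ratPlusSymbol f (x + k) : ℚ) : ℚ_[2]) = _; rw [ratPlusSymbol_add_intCast_eq]
  -- the two depletion identities modulo `ω_n`
  have hR := layerSum_mul_prod_eulerFactor_congr (fun x ↦ ((ratPlusSymbol f x : ℚ) : ℚ_[2])) hneg hper S₀
    (fun v ↦ Rat.HeightOneSpectrum.natGenerator v) hodd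
    (fun v ↦ (W.localPolynomialAt v).map (Int.castRingHom ℚ_[2])) (d := 2)
    (fun v _ ↦ (natDegree_map_le).trans (WeierstrassCurve.natDegree_localPolynomial_le_two _)) n
  have hL := layerSum_mul_prod_dvd_sub_layerSum_eulerDepleteTableList W S₀.toList hoddl (ratPlusSymbol f)
    (ratPlusSymbol_neg f) (ratPlusSymbol_add_intCast_eq f) n
  rw [Finset.prod_map_toList] at hL
  have hdiff : ((X + 1 : ℚ_[2][X]) ^ 2 ^ n - 1) ∣
      (∑ s : ZMod (2 ^ n), C (((eulerDepleteTableList W S₀.toList (ratPlusSymbol f) ((((cyclotomicGenerator 2 : ZMod (2 ^ (n + 2))) ^ s.val).val : ℚ) / (2 : ℚ) ^ (n + 2)) : ℚ) : ℚ_[2])) * (X + 1 : ℚ_[2][X]) ^ s.val) -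
        ∑ s : ZMod (2 ^ n), C (∑ k ∈ Fintype.piFinset (fun _ : S₀ ↦ Finset.range (2 + 1)), (∏ a : S₀, ((W.localPolynomialAt (a : IsDedekindDomain.HeightOneSpectrum (NumberField.RingOfIntegers ℚ))).map (Int.castRingHom ℚ_[2])).coeff (k a) * ((Rat.HeightOneSpectrum.natGenerator (a : IsDedekindDomain.HeightOneSpectrum (NumberField.RingOfIntegers ℚ)) : ℚ_[2])⁻¹) ^ (k a)) * ((ratPlusSymbol f (((((cyclotomicGenerator 2 : ZMod (2 ^ (n + 2))) ^ s.val).val : ℚ) / (2 : ℚ) ^ (n + 2)) * ((∏ a : S₀, Rat.HeightOneSpectrum.natGenerator (a : IsDedekindDomain.HeightOneSpectrum (NumberField.RingOfIntegers ℚ)) ^ (k a) : ℕ) : ℚ)) : ℚ) : ℚ_[2])) * (X + 1 : ℚ_[2][X]) ^ s.val := by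
    have h := dvd_sub hR hL
    rw [sub_sub_sub_cancel_left] at h
    exact h
  -- the difference is a layer sum of degree `< 2ⁿ` divisible by the monic `ω_n`: it vanishes
  have hmonic : ((X + 1 : ℚ_[2][X]) ^ 2 ^ n - 1).Monic := by
    have hX : (X + 1 : ℚ_[2][X]) = X + C 1 := by rw [C_1]
    have h1 : ((X + 1 : ℚ_[2][X]) ^ 2 ^ n).Monic := by rw [hX]; exact (monic_X_add_C 1).pow _
    apply h1.sub_of_left
    rw [degree_one, degree_eq_natDegree h1.ne_zero, hX, natDegree_pow, natDegree_X_add_C, mul_one]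
    exact_mod_cast pow_pos two_pos n
  have hdeg2n : ((X + 1 : ℚ_[2][X]) ^ 2 ^ n - 1).degree = ((2 ^ n : ℕ) : WithBot ℕ) := by
    rw [degree_eq_natDegree hmonic.ne_zero, ← C_1, natDegree_sub_C, natDegree_pow_X_add_C]
  rw [← Finset.sum_sub_distrib] at hdiff
  simp only [← sub_mul, ← map_sub] at hdiff
  have hlt : (∑ s : ZMod (2 ^ n), C (((eulerDepleteTableList W S₀.toList (ratPlusSymbol f) ((((cyclotomicGenerator 2 : ZMod (2 ^ (n + 2))) ^ s.val).val : ℚ) / (2 : ℚ) ^ (n + 2)) : ℚ) : ℚ_[2]) - (∑ k ∈ Fintype.piFinset (fun _ : S₀ ↦ Finset.range (2 + 1)), (∏ a : S₀, ((W.localPolynomialAt (a : IsDedekindDomain.HeightOneSpectrum (NumberField.RingOfIntegers ℚ))).map (Int.castRingHom ℚ_[2])).coeff (k a) * ((Rat.HeightOneSpectrum.natGenerator (a : IsDedekindDomain.HeightOneSpectrum (NumberField.RingOfIntegers ℚ)) : ℚ_[2])⁻¹) ^ (k a)) * ((ratPlusSymbol f (((((cyclotomicGenerator 2 : ZMod (2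 ^ (n + 2))) ^ s.val).val : ℚ) / (2 : ℚ) ^ (n + 2)) * ((∏ a : S₀, Rat.HeightOneSpectrum.natGenerator (a : IsDedekindDomain.HeightOneSpectrum (NumberField.RingOfIntegers ℚ)) ^ (k a) : ℕ) : ℚ)) : ℚ) : ℚ_[2]))) * (X + 1 : ℚ_[2][X]) ^ s.val).degree <
      ((X + 1 : ℚ_[2][X]) ^ 2 ^ n - 1).degree := by
    rw [hdeg2n]
    refine Polynomial.degree_le_natDegree.trans_lt ?_
    exact_mod_cast natDegree_layerSum_lt (K := ℚ_[2])
      (fun t ↦ ((eulerDepleteTableList W S₀.toList (ratPlusSymbol f) ((((cyclotomicGenerator 2 : ZMod (2 ^ (n + 2))) ^ t).val : ℚ) / (2 : ℚ) ^ (n + 2)) : ℚ) : ℚ_[2]) - (∑ k ∈ Fintype.piFinset (fun _ : S₀ ↦ Finset.range (2 + 1)), (∏ a : S₀, ((W.localPolynomialAt (a : IsDedekindDomain.HeightOneSpectrum (NumberField.RingOfIntegers ℚ))).map (Int.castRingHom ℚ_[2])).coeff (k a) * ((Rat.HeightOneSpectrum.natGenerator (a : IsDedekindDomain.HeightOneSpectrum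 (NumberField.RingOfIntegers ℚ)) : ℚ_[2])⁻¹) ^ (k a)) * ((ratPlusSymbol f (((((cyclotomicGenerator 2 : ZMod (2 ^ (n + 2))) ^ t).val : ℚ) / (2 : ℚ) ^ (n + 2)) * ((∏ a : S₀, Rat.HeightOneSpectrum.natGenerator (a : IsDedekindDomain.HeightOneSpectrum (NumberField.RingOfIntegers ℚ)) ^ (k a) : ℕ) : ℚ)) : ℚ) : ℚ_[2]))) n
  have hzero := Polynomial.eq_zero_of_dvd_of_degree_lt hdiff hlt
  have hcoef := layerSum_coeff_injective (fun s : ZMod (2 ^ n) ↦ ((eulerDepleteTableList W S₀.toList (ratPlusSymbol f) ((((cyclotomicGenerator 2 : ZMod (2 ^ (n + 2))) ^ s.val).val : ℚ) / (2 : ℚ) ^ (n + 2)) : ℚ) : ℚ_[2]))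
    (fun s : ZMod (2 ^ n) ↦ (∑ k ∈ Fintype.piFinset (fun _ : S₀ ↦ Finset.range (2 + 1)), (∏ a : S₀, ((W.localPolynomialAt (a : IsDedekindDomain.HeightOneSpectrum (NumberField.RingOfIntegers ℚ))).map (Int.castRingHom ℚ_[2])).coeff (k a) * ((Rat.HeightOneSpectrum.natGenerator (a : IsDedekindDomain.HeightOneSpectrum (NumberField.RingOfIntegers ℚ)) : ℚ_[2])⁻¹) ^ (k a)) * ((ratPlusSymbol f (((((cyclotomicGenerator 2 : ZMod (2 ^ (n + 2))) ^ s.val).val : ℚ) / (2 : ℚ) ^ (n + 2)) * ((∏ a : S₀, Rat.HeightOneSpectrum.natGenerator (a : IsDedekindDomain.HeightOneSpectrum (NumberField.RingOfIntegers ℚ)) ^ (k a) : ℕ) : ℚ)) : ℚ) : ℚ_[2]))) (by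
      rw [← sub_eq_zero, ← Finset.sum_sub_distrib]
      simp only [← sub_mul, ← map_sub]
      exact hzero) s
  -- back to `ℚ`: the expanded table over `ℚ₂` is the image of the rational one
  have hcast := expandedTable_eq_algebraMap W f S₀ ℚ_[2] ((((cyclotomicGenerator 2 : ZMod (2 ^ (n + 2))) ^ s.val).val : ℚ) / (2 : ℚ) ^ (n + 2))
  simp only [eq_ratCast] at hcast
  have h3 : Finset.range (2 + 1) = Finset.range 3 := rfl
  simp only [h3] at hcoef
  rw [hcast] at hcoef
  exact_mod_cast hcoef.symm

end Link

/-! ## §3. (PAR2) at the odd-numerator `2`-power cusps, from the six facts + trace congruence + two `μ`-hypotheses -/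

section Parity

variable {W : WeierstrassCurve ℚ} [W.IsElliptic] [W.IsGloballyMinimal] [NeZero (W.conductorNorm ℤ)]
  {A : WeierstrassCurve ℚ} [A.IsElliptic] [A.IsGloballyMinimal] [NeZero (A.conductorNorm ℤ)]
  {f : CuspForm (Gamma0 (W.conductorNorm ℤ)) 2} {fA : CuspForm (Gamma0 (A.conductorNorm ℤ)) 2}

/-- **(PAR2) at the cusps from print + `μ`**: for `W` on the habitat⁺ (good supersingular at `2`, `Δ_W < 0`, analytic rank `0`,
newform `f`), a `2`-congruent partner `A` good at `2` of analytic rank `0` (newform `f_A`; trace congruence `hcong`), an admissible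
`S₀`, and `ϖ, ϖ_A ∈ ℚ` whose doubled expanded tables take a unit value at a point of maximal `|Ψ|`: the doubled LIST tables agree
mod `2` at every odd-numerator `2`-power cusp — `‖2ϖΦ^l_W(a/2^{n+2}) − 2ϖ_AΦ^l_A(a/2^{n+2})‖₂ ≤ ‖2‖₂`, `l = S₀.toList`, i.e. the
conclusion of (PAR2) (`…ROfSymbolParity`) for this pair — GRANTED the six named facts of the plus line (Eichler–Shimura, Faltings,
Mazur–Kenku, self-duality, Buzzard, Serre). [cite: Buzzard2000LevelLoweringModTwo, Prop. 2.4] [cite: GreenbergVatsal2000, Thm. (1.4), §3 (13)] -/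
theorem parity_cusps_of_congruent_of_facts
    (hES : eichlerShimura_depletedOptimalQuotient_periodLattice_of_dvd)
    (hF : WeierstrassCurve.isIsogenous_iff_frobeniusTrace_eq) (hMK : mazurKenku_exists_cyclic_isogeny)
    (hSD : heckeSelfDual_torsionBy_J0) (hBz : buzzard2000_multiplicityOne_gamma0)
    (hSe : serre1972_supersingular_decompositionSubgroup_image)
    (hss : Literature.NumberTheory.EllipticCurves.Rank1Residual.GoodSS W 2) (hΔ : W.Δ < 0) (hf : IsNewformOf W f)
    (hr : W.analyticRank = 0) (hssA : Literature.NumberTheory.EllipticCurves.Rank1Residual.GoodSS A 2)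
    (hfA : IsNewformOf A fA) (hrA : A.analyticRank = 0)
    (hcong : ∀ q : ℕ, q.Prime → ¬ q ∣ W.conductorNorm ℤ → ¬ q ∣ A.conductorNorm ℤ →
      ‖(A.LFunction q : PadicAlgCl 2) - (W.LFunction q : PadicAlgCl 2)‖ < 1)
    (S₀ : Finset (IsDedekindDomain.HeightOneSpectrum (NumberField.RingOfIntegers ℚ)))
    (hS2 : ∀ v ∈ S₀, ((2 : ℕ) : NumberField.RingOfIntegers ℚ) ∉ v.asIdeal)
    (hSW : ∀ v : IsDedekindDomain.HeightOneSpectrum (NumberField.RingOfIntegers ℚ), ¬ W.HasGoodReductionAt v → v ∈ S₀)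
    (hSA : ∀ v : IsDedekindDomain.HeightOneSpectrum (NumberField.RingOfIntegers ℚ), ¬ A.HasGoodReductionAt v → v ∈ S₀)
    (ϖ ϖA : ℚ)
    (hμW : ∃ x₀ : ℚ, (∀ r : ℚ, ‖(∑ k ∈ Fintype.piFinset (fun _ : S₀ ↦ Finset.range 3), (∏ v : S₀, ((W.localPolynomialAt (v : IsDedekindDomain.HeightOneSpectrum (NumberField.RingOfIntegers ℚ))).map (Int.castRingHom (PadicAlgCl 2))).coeff (k v) * ((Rat.HeightOneSpectrum.natGenerator (v : IsDedekindDomain.HeightOneSpectrum (NumberField.RingOfIntegers ℚ)) : PadicAlgCl 2)⁻¹) ^ (k v)) * algebraMap ℚ (PadicAlgCl 2) (ratPlusSymbol f (r * ((∏ v : S₀, Rat.HeightOneSpectrum.natGenerator (v : IsDedekindDomain.HeightOneSpectrum (NumberField.RingOfIntegers ℚ)) ^ (k v) : ℕ) : ℚ))))‖ ≤ ‖(∑ k ∈ Fintype.piFinset (fun _ : S₀ ↦ Finset.range 3), (∏ v : S₀, ((W.localPolynomialAt (v : IsDedekindDomain.HeightOneSpectrum (NumberField.RingOfIntegers ℚ))).map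 (Int.castRingHom (PadicAlgCl 2))).coeff (k v) * ((Rat.HeightOneSpectrum.natGenerator (v : IsDedekindDomain.HeightOneSpectrum (NumberField.RingOfIntegers ℚ)) : PadicAlgCl 2)⁻¹) ^ (k v)) * algebraMap ℚ (PadicAlgCl 2) (ratPlusSymbol f (x₀ * ((∏ v : S₀, Rat.HeightOneSpectrum.natGenerator (v : IsDedekindDomain.HeightOneSpectrum (NumberField.RingOfIntegers ℚ)) ^ (k v) : ℕ) : ℚ))))‖) ∧
      ‖algebraMap ℚ (PadicAlgCl 2) (2 * ϖ) * (∑ k ∈ Fintype.piFinset (fun _ : S₀ ↦ Finset.range 3), (∏ v : S₀, ((W.localPolynomialAt (v : IsDedekindDomain.HeightOneSpectrum (NumberField.RingOfIntegers ℚ))).map (Int.castRingHom (PadicAlgCl 2))).coeff (k v) * ((Rat.HeightOneSpectrum.natGenerator (v : IsDedekindDomain.HeightOneSpectrum (NumberField.RingOfIntegers ℚ)) : PadicAlgCl 2)⁻¹) ^ (k v)) * algebraMap ℚ (PadicAlgCl 2) (ratPlusSymbol f (x₀ * ((∏ v : S₀, Rat.HeightOneSpectrum.natGenerator (v : IsDedekindDomain.HeightOneSpectrum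 (NumberField.RingOfIntegers ℚ)) ^ (k v) : ℕ) : ℚ))))‖ = 1)
    (hμA : ∃ x₀ : ℚ, (∀ r : ℚ, ‖(∑ k ∈ Fintype.piFinset (fun _ : S₀ ↦ Finset.range 3), (∏ v : S₀, ((A.localPolynomialAt (v : IsDedekindDomain.HeightOneSpectrum (NumberField.RingOfIntegers ℚ))).map (Int.castRingHom (PadicAlgCl 2))).coeff (k v) * ((Rat.HeightOneSpectrum.natGenerator (v : IsDedekindDomain.HeightOneSpectrum (NumberField.RingOfIntegers ℚ)) : PadicAlgCl 2)⁻¹) ^ (k v)) * algebraMap ℚ (PadicAlgCl 2) (ratPlusSymbol fA (r * ((∏ v : S₀, Rat.HeightOneSpectrum.natGenerator (v : IsDedekindDomain.HeightOneSpectrum (NumberField.RingOfIntegers ℚ)) ^ (k v) : ℕ) : ℚ))))‖ ≤ ‖(∑ k ∈ Fintype.piFinset (fun _ : S₀ ↦ Finset.range 3), (∏ v : S₀, ((A.localPolynomialAt (v : IsDedekindDomain.HeightOneSpectrum (NumberField.RingOfIntegers ℚ))).map (Int.castRingHom (PadicAlgCl 2))).coeff (k v) * ((Rat.HeightOneSpectrum.natGenerator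 (v : IsDedekindDomain.HeightOneSpectrum (NumberField.RingOfIntegers ℚ)) : PadicAlgCl 2)⁻¹) ^ (k v)) * algebraMap ℚ (PadicAlgCl 2) (ratPlusSymbol fA (x₀ * ((∏ v : S₀, Rat.HeightOneSpectrum.natGenerator (v : IsDedekindDomain.HeightOneSpectrum (NumberField.RingOfIntegers ℚ)) ^ (k v) : ℕ) : ℚ))))‖) ∧
      ‖algebraMap ℚ (PadicAlgCl 2) (2 * ϖA) * (∑ k ∈ Fintype.piFinset (fun _ : S₀ ↦ Finset.range 3), (∏ v : S₀, ((A.localPolynomialAt (v : IsDedekindDomain.HeightOneSpectrum (NumberField.RingOfIntegers ℚ))).map (Int.castRingHom (PadicAlgCl 2))).coeff (k v) * ((Rat.HeightOneSpectrum.natGenerator (v : IsDedekindDomain.HeightOneSpectrum (NumberField.RingOfIntegers ℚ)) : PadicAlgCl 2)⁻¹) ^ (k v)) * algebraMap ℚ (PadicAlgCl 2) (ratPlusSymbol fA (x₀ * ((∏ v : S₀, Rat.HeightOneSpectrum.natGenerator (v : IsDedekindDomain.HeightOneSpectrum (NumberField.RingOfIntegers ℚ)) ^ (k v) : ℕ)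 : ℚ))))‖ = 1)
    (n a : ℕ) (ha : Odd a) :
    ‖((2 * ϖ * eulerDepleteTableList W S₀.toList (ratPlusSymbol f) ((a : ℚ) / (2 : ℚ) ^ (n + 2)) : ℚ) : ℚ_[2]) -
        ((2 * ϖA * eulerDepleteTableList A S₀.toList (ratPlusSymbol fA) ((a : ℚ) / (2 : ℚ) ^ (n + 2)) : ℚ) : ℚ_[2])‖ ≤ ‖(2 : ℚ_[2])‖ := by
  have hAodd : Odd (A.conductorNorm ℤ) := by
    have h2A : ¬ 2 ∣ A.conductorNorm ℤ := by
      rw [A.dvd_conductorNorm_iff_not_hasGoodReductionAtPrime 2, not_not]; exact hssA.1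
    exact Nat.odd_iff.mpr (Nat.two_dvd_ne_zero.mp h2A)
  -- the odd numerator `a` is `± 5^F (mod 2^{n+2})`: move to the cusp `5^{s₀}/2^{n+2}`
  have ha2 : ¬ 2 ∣ a := fun h ↦ (Nat.not_even_iff_odd.mpr ha) (even_iff_two_dvd.mpr h)
  obtain ⟨ω, hω, haω⟩ := exists_sign_mul_cyclotomicGenerator_pow_eq ha2 n
  set F₀ : ℕ := (PadicInt.toZModPow n (frobeniusExponent 2 (a : ℤ_[2]))).val with hF₀
  set s₀ : ZMod (2 ^ n) := (F₀ : ZMod (2 ^ n)) with hs₀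
  have hs₀v : s₀.val = F₀ % 2 ^ n := ZMod.val_natCast (2 ^ n) F₀
  haveI : Fact (1 < 2 ^ (n + 2)) := ⟨Nat.one_lt_two_pow (by omega)⟩
  have hxa : ∀ ψ : ℚ → ℚ, (∀ x, ψ (-x) = ψ x) → (∀ (x : ℚ) (z : ℤ), ψ (x + z) = ψ x) →
      ψ ((a : ℚ) / (2 : ℚ) ^ (n + 2)) = ψ ((((cyclotomicGenerator 2 : ZMod (2 ^ (n + 2))) ^ s₀.val).val : ℚ) / (2 : ℚ) ^ (n + 2)) := by
    intro ψ hneg hper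
    have h := apply_mul_cyclotomicGenerator_pow_val_div ψ hneg hper hω haω 0
    rw [pow_zero, ZMod.val_one, zero_add, Nat.cast_one, ← mul_div_assoc, mul_one] at h
    rw [h, hs₀v, ← cyclotomicGenerator_two_pow_eq_pow_mod]
  have hlW := hxa _ (eulerDepleteTableList_neg W S₀.toList (ratPlusSymbol_neg f))
    (eulerDepleteTableList_add_intCast' W S₀.toList (ratPlusSymbol_add_intCast_eq f))
  have hlA := hxa _ (eulerDepleteTableList_neg A S₀.toList (ratPlusSymbol_neg fA))
    (eulerDepleteTableList_add_intCast' A S₀.toList (ratPlusSymbol_add_intCast_eq fA))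
  rw [hlW, hlA, ← expandedTable_cusp_eq_eulerDepleteTableList W f S₀ hS2 n s₀,
    ← expandedTable_cusp_eq_eulerDepleteTableList A fA S₀ hS2 n s₀]
  -- the bridge at `r = 5^{s₀}/2^{n+2}`, read through `ℚ → ℚ₂ → ℚ̄₂`
  have hB := depletedParity_of_congruent_of_facts hES hF hMK hSD hBz hSe hss hΔ hf hr hAodd hfA hrA hcong S₀ hS2 hSW hSA
    ϖ ϖA hμW hμA ((((cyclotomicGenerator 2 : ZMod (2 ^ (n + 2))) ^ s₀.val).val : ℚ) / (2 : ℚ) ^ (n + 2))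
  rw [expandedTable_eq_algebraMap W f S₀ (PadicAlgCl 2), expandedTable_eq_algebraMap A fA S₀ (PadicAlgCl 2),
    ← map_mul, ← map_mul, ← map_sub] at hB
  have hcastq : ∀ q : ℚ, algebraMap ℚ (PadicAlgCl 2) q = algebraMap ℚ_[2] (PadicAlgCl 2) (q : ℚ_[2]) := by
    intro q; rw [map_ratCast, eq_ratCast]
  rw [hcastq, PadicAlgCl.norm_extends (p := 2)] at hB
  push_cast at hB ⊢
  -- a `ℚ₂`-norm `< 1` is `≤ ‖2‖`
  have h := (Padic.norm_le_pow_iff_norm_lt_pow_add_one _ (-1)).mpr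
    (by rw [show (-1 : ℤ) + 1 = 0 from by norm_num, zpow_zero]; exact hB)
  have h2n : ‖(2 : ℚ_[2])‖ = (2 : ℝ)⁻¹ := by
    have h' := Padic.norm_p (p := 2); exact_mod_cast h'
  have h3 : ((2 : ℕ) : ℝ) ^ (-1 : ℤ) = (2 : ℝ)⁻¹ := by norm_num
  rw [h2n, ← h3]
  convert h using 2

end Parity

end Summit.BirchSwinnertonDyer.BirchSwinnertonDyer.Theorems.MazurTateCongruenceAtTwoR

end
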